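/-
# `Balaban1983to89.B5OneH128Torus` — Bałaban CMP 95 (1984): the (1.126) ⟹ (1.128) schema IN THE `ℓ¹` CURRENCY of the p. 39 adjoint
# representation (Part A, generic), the leaf (1.128) ON THE ADJOINT (`ℓ¹`) CARRIER OF RECORD for `Δ_a` of record, and the adjoint
# representation `B5SupWalkS1.Rep` of `G = Δ_a⁻¹` INHABITED (Part B)

statement-level skeleton of published theorems with citation tags; proofs where landed; nothing here is a claim
about the Yang–Mills mass gap

CITATION HEADER (lean-in-tree rule).  Cell `lit-balaban`, unit `lit-balaban-r02` (reader/typer r02 gen 11 = fold owner of block B5),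
HOME `run/shared/lean/pub/lit-balaban/` (SKELETON rows B5.Eq1.128 / B5.Eq1.121 / B5.Eq1.123 / B5.Prop1.2 cells; S1-torus programme,
`lit-balaban-r02/B5-CLOSURE.md` v1.3 §3 item 5; the piece «ℓ¹ twin of (1.128) + adjoint Rep» of the r02 ∕ p38-gen-8 ∕ r05-gen-17 split,
HOME/STATUS.md 2026-08-22T03:18–04:27Z, specified by p38 gen 8 at 03:50:41Z).  B5 = T. Bałaban, *Propagators and renormalization
transformations for lattice gauge theories. I*, Commun. Math. Phys. **95** (1984) 17–40 [`Balaban1984PropagatorsI`], held as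
`paper:balaban1984-cmp95-propagators-rt-i` (pp. 37–39 = text layer p0021–p0023).  ONE FILE = the `ℓ¹` twins of own `B5SupCommutator128` (p315722,
the `ℓ^∞` schema; here Part A) and of own `B5SupRepTorus` (p317540, the sup instantiation + direct `Rep`; here Part B) — merged to save one
review round-trip on the critical path of p38 gen 8's certificate files; carrier, operators and the fields `h118`/`h71`/`normH`/`h115` of the
adjoint representation are p38 gen 8's `B5SupCarrierTorus` (p316435: `V1 = PiLp 1 (Bnd n M → ℝ)`, `G1/DA1/H1/Dg1`, `h118one`, `DA1_mul_G1`,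
`G1_mul_DA1`, `norm_H1_le`, `h115one_holds`); the one-axis Leibniz identity and the multiplier estimates are p38 gen 7's `B5WalkH128Torus`.

WHAT IS PRINTED.  p. 39 [PDF 23] L7–9, verbatim: «The proofs of the other inequalities are exactly the same, but in the estimates of
G∇*J we have to take a representation of G adjoint to (1.123), with the operators K(h) acting on the right.»; p. 38 [PDF 22] (1.128);
p. 37 [PDF 21] (1.121), verbatim (render p021): «Δ_ahA = (Δ − ∂P∂* + aQ*Q)hA = hΔ_aA − [Σ_{b∈st(·)}(∂h)(b)(∂A)(b) − (Δh)A + S*(∂h)QA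
− Q*S(∂h)A + P₁(∂h)A] = hΔ_aA − K(h)A, (1.121)».  READING (ours, outside the quotation): the `∂P∂*`-part `P₁(∂h)A` of `K(h)A` is the
commutator `∂*P∂*(hA) − h∂*P∂*A`, which the tree's carriers expand entrywise (p38 gen 7's `B5WalkH128Torus`, kernel part via (1.126)).
(v1.1, r05 SECOND-READ-B5 pass 22 note 22-(c): v1 printed an expanded/garbled bracket — «… − (ΔA)A + … + ∂*P(∂h)A − (∂h)P∂*A + h∂*P∂*A −
∂*P∂*hA» — inside the guillemets; replaced by the printed display, the expansion labelled READING; declarations byte-identical to v1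
p318614.)

PART A — THE `ℓ¹` SCHEMA (kernel-checked, zero sorry), for a finite index type `ι`, positions `π : ι → X` in a pseudo-metric space:
§A1 the `ℓ¹` size `l1 v = Σ_i |v i|` (`l1_nonneg`, `l1_zero`, `l1_add_le`, `l1_sum_le`, `l1_comp_equiv`, `l1_const_mul`, `l1_mul_le`,
   `l1_mulOpS_le`: `|a| ≤ C ⇒ l1 (a·v) ≤ C·l1 v`);
§A2 **the `ℓ¹ → ℓ¹` bound of a kernel operator from absolute COLUMN sums alone** `(∀ j, Σ_i |k_ij| ≤ R) ⇒ l1 (kerOpS k v) ≤ R·l1 v`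
   (`l1_kerOpS_le`; the `ℓ¹` norm of `k` is the `ℓ^∞` norm of `kᵀ`), and its decay forms `l1_kerOpS_le_of_decay` / `…_decay'`
   (an entrywise majorant `B e^{−β dist(π i, π j)}` has column sums `≤ BΛ` by the symmetry of `dist` and the ROW-sum hypothesis `Λ`);
§A3 the KERNEL PART of (1.128) in `ℓ¹`: `l1_three_kernel_le` (multiplier on the left), `l1_kernel_three_le` (multiplier on the right),
   `l1_comm_kernel_le` (unpaired) — b05's norm-free entry majorant `B5Commutator128.entry_three_le` read through §A2, SAME constants as the
   `ℓ^∞` twin (`ℓ·C·(24/(eδ))·Λ·e^{−(5δ/6)(dist(c₁,c₂) − 2s)⁺}`);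
§A4 `SchemaOne` = own `SchemaS` with the normed local hypothesis in `ℓ¹` form against an arbitrary nonnegative size functional `N`
   (model: `N A = Σ_{ν,b} |(∇_ν A)(b)| = ‖Dg1 A‖` of p38's `Vg1`): `l1 ([H z, kerOpS l] A) ≤ ℓ₁(N A + l1 A)`;
§A5 ASSEMBLY **`h128_schemaOne`**: `l1 (H z₁ (Kop Δa H z₂ A)) ≤ (ℓ₁·e^{4+ρ/M₀} + ℓ·C·(24/(eδ))·Λ·e^7)·e^{−twoDelta0 δ M₀·dist(c z₁, c z₂)}·
   (N A + l1 A)` for `Δa = kerOpS l + kerOpS k`, `H z = mulOpS (a z)` — EXACTLY the statement shape of own `h128_schemaS` (hence of the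
   field `Rep.h128` of `B5SupWalkS1` once `l1`/`N` are read as the norms of `V1`/`Vg1`); + `kernel_right_l1_le` (the kernel half with the
   multiplier on the right).

PART B — THE OPERATORS OF RECORD (kernel-checked, zero sorry; uniform in `η = n⁻¹`, the volume and `M₀ ≥ 1`):
§B1 THE (1.121) LOCAL BOUND IN `ℓ¹` on real vector fields `Bnd n M → ℝ`: `l1_fdiffR_transpose_eq` (`Σ|∇ᵀ_ν v| = Σ|∇_ν v|`, translation
   invariance), the three pieces of p38's one-axis Leibniz identity `commR_axis_eq` in `ℓ¹` (`l1_piece1_le`, `l1_piece2_le`, `l1_piece3_le`),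
   `l1_commR_axis_le` (`Σ_b|[h_z, ∇_νᵀ∇_ν]v(b)| ≤ 2(Lw/M₀)Σ|∇_ν v| + (K2/M₀²)Σ|v|`), the `ℓ¹` gradient size `NgOne v = Σ_ν Σ_b |(∇_ν v)(b)|`
   (= `‖Dg1 A‖`, `norm_Dg1_eq_NgOne`), `l1_commR_LapR_le` (`≤ 2(Lw/M₀)·NgOne v + d(K2/M₀²)·l1 v` — NO factor `d` on the gradient, the sum
   over axes IS the `ℓ¹` gradient size), `l1_commR_QQR_le` (`≤ 4(Lw/M₀)·l1 v` by COLUMN sums of `Q*Q`, p37's `QQ_colsum`), `l1_commR_Lloc_le`,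
   **`local_l1_holds`**: `l1 ([h_z, Δ + aQ*Q] v) ≤ ℓ₁(NgOne v + l1 v)` with THE SAME `ℓ₁ = (2dLw + dK2 + 4|a|Lw)/M₀` as the sup side;
§B2 `schemaOne_holds` (Part A's `SchemaOne` on `ι = T_η × {1..d}`: profiles `hcoefS`, centres `ctr`, local part `Lloc`, kernel part `kmat`, size
   `NgOne`, plain row sums `d·η^{−d}e^{δ/4}K_d(δ/8)` = own `B5SupRepTorus.rowsum_plain_le`) and `h128one_l1` (the `ℓ¹` bound for the real
   operators `Hs/DAs` read with `l1`, constant `thetaW d a δ C/M₀` — the plain row sum lacks the factor `|Gr d| ≥ 1`);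
§B3 THE ADJOINT CARRIER: `norm_V1_eq_l1`, `norm_Dg1_eq_NgOne`, `ofLp_Kop_H1_DA1` (p38's `G1/DA1/H1` act through `ofLp`), and
   **`h128one_holds`**: `‖H1 z₁ (Kop (DA1 n M a) (H1 n M M₀) z₂ A)‖ ≤ (thetaW d a δ C/M₀)·e^{−twoDelta0 δ M₀·dist(ctr z₁, ctr z₂)}·(‖Dg1 A‖ + ‖A‖)`
   given ‖(∂P∂*)_{ij}‖ ≤ Cη^d e^{−δ|x_i−x_j|} — THE SAME CONSTANT `thetaW` AS THE SUP SIDE (`B5SupRepTorus.h128P_holds`), so ONE `κ.thetaBar`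
   serves both representations;
§B4 **`repOne`** — `B5SupWalkS1.Rep (latticeSettingP12R n M a k) (kdW n M) (gP12R M n a k) M₀ κ (V1 n M) (Vg1 n M) (TorR M) (Cen M M₀) (ctr M M₀)`
   INHABITED for every `n ≥ 1`, torus, `a > 0`, `k`, `M₀ ≥ 1`, every `κ` with `thetaW d a ≤ κ.thetaBar` (on `δ > 0`, `C ≥ 0`) and `1 ≤ κ.cG`
   (fields from p38's FILE A; `h128` = §3 ∘ p38's `entry_le_of_kdW`); `repOne_thetaBarS` at `κ.thetaBar = B5SupRepTorus.thetaBarS d a`.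

HONEST SCOPE.  (1) As the sup side: (1.126) is the HYPOTHESIS of `Rep.h128` on `kdW` (p16's theorem discharges it where `SupRealisation` is
consumed); constants ours; rate exact.  (2) The adjoint representation is MODELLED by the `ℓ¹` carrier with the same symmetric operators (as
announced in `B5SupWalkS1` and `B5SupCarrierTorus`); print names no norm for it.  (3) `Rep` is one slot of `SupRealisation`; the Hölder
factor estimates and the `DomCert`s are p38 gen 8's files B–D.  Value = the adjoint representation of the printed sup walk for `Δ_a` of record
available to the certificate files (with the direct one, `B5SupRepTorus.repS`), NOT summit progress.
-/
import Mathlib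
import Literature.MathematicalPhysics.QuantumFieldTheory.Balaban1983to89.B5SupRepTorus

open scoped BigOperators Matrix
open Finset Matrix WithLp

namespace Literature.MathematicalPhysics.QuantumFieldTheory.Balaban1983to89.B5OneH128Torus

open Literature.MathematicalPhysics.QuantumFieldTheory.Balaban1983to89
open Literature.MathematicalPhysics.QuantumFieldTheory.Balaban1983to89.B5Prop11Plancherel (Tor fine)
open Literature.MathematicalPhysics.QuantumFieldTheory.Balaban1983to89.B5Prop12FieldsLattice (distU distU_nonneg)
open Literature.MathematicalPhysics.QuantumFieldTheory.Balaban1983to89.B5DeltaA169 (QvAdj)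
open Literature.MathematicalPhysics.QuantumFieldTheory.Balaban1983to89.B5Block118 (QvOp)
open Literature.MathematicalPhysics.QuantumFieldTheory.Balaban1983to89.B5Walk131 (twoDelta0)
open Literature.MathematicalPhysics.QuantumFieldTheory.Balaban1983to89.B5CombesThomasLattice (nb QQ_colsum distU_le_four_of_QQ_ne_zero)
open Literature.MathematicalPhysics.QuantumFieldTheory.Balaban1983to89.B5CoverP12Lattice (Lw Lw_nonneg)
open Literature.MathematicalPhysics.QuantumFieldTheory.Balaban1983to89.B5Local114 (Kop)
open Literature.MathematicalPhysics.QuantumFieldTheory.Balaban1983to89.B5RealFields (fdiffR LapR DeltaAR)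
open Literature.MathematicalPhysics.QuantumFieldTheory.Balaban1983to89.B5SettingP12Real (VecR latticeSettingP12R gP12R)
open Literature.MathematicalPhysics.QuantumFieldTheory.Balaban1983to89.B5WalkTorusGeom (TorR ucPt Cen ctr)
open Literature.MathematicalPhysics.QuantumFieldTheory.Balaban1983to89.B5WalkPartitionTorus (hz abs_hz_sub_le
  dist_ctr_le_of_hz_ne_zero)
open Literature.MathematicalPhysics.QuantumFieldTheory.Balaban1983to89.B5WalkCarrierTorus (Gr Bnd)
open Literature.MathematicalPhysics.QuantumFieldTheory.Balaban1983to89.B5WalkH128Torus (pb nb_pb pb_nb nbEquiv gz abs_gz_le_one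
  abs_gz_nb_sub_le abs_gz_pb_sub_le abs_gz_second_diff_le abs_gz_sub_le K2 K2_nonneg commR commR_apply commR_add commR_smul commR_sum
  commR_axis_eq piece1 piece2 piece3 fdiffR_mulVec_apply fdiffR_transpose_mulVec_apply LapR_eq_sum QQR abs_QQR_le Lloc
  distU_le_of_Lloc_ne_zero VC kmat abs_kmat_le thetaW thetaW_nonneg DeltaAR_eq_Lloc_add_kmat dist_ucPt_eq_distU)
open Literature.MathematicalPhysics.QuantumFieldTheory.Balaban1983to89.B5WalkRealisationTorus (kdW entry_le_of_kdW)
open Literature.MathematicalPhysics.QuantumFieldTheory.Balaban1983to89.B5SupWalk131 (SupConsts)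
open Literature.MathematicalPhysics.QuantumFieldTheory.Balaban1983to89.B5SupWalkS1 (Rep)
open Literature.MathematicalPhysics.QuantumFieldTheory.Balaban1983to89.B5Commutator128 (entry_three_le exp_sep_le one_le_exp_local
  mul_exp_half Kop_add)
open Literature.MathematicalPhysics.QuantumFieldTheory.Balaban1983to89.B5SupCommutator128 (kerOpS kerOpS_apply mulOpS mulOpS_apply
  three_eq_kerOpS comm_mulOpS_kerOpS comm_mul_mulOpS_eq_kerOpS three_local_eq_zeroS local_three_eq_zeroS)
open Literature.MathematicalPhysics.QuantumFieldTheory.Balaban1983to89.B5SupCarrierTorus (hcoefS Hs DAs Hs_eq abs_hcoefS_le_one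
  DAs_eq_kerOpS_add V1 Vg1 eS G1 DA1 H1 Dg1 norm_V1 norm_Vg1 ofLp_conj_apply Dg1_apply h118one DA1_mul_G1 G1_mul_DA1 norm_H1_le
  h115one_holds)
open Literature.MathematicalPhysics.QuantumFieldTheory.Balaban1983to89.B5SupRepTorus (comm_plain_apply rowsum_plain_le DAs_eq_split
  thetaBarS thetaW_le_thetaBarS)

noncomputable section

/-! # PART A — the `ℓ¹` schema (generic index type; the twin of `B5SupCommutator128`) -/
/-! ## §1  The `ℓ¹` size functional -/

section L1

variable {ι : Type} [Fintype ι]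

/-- **the `ℓ¹` size** `l1 v = Σ_i |v i|` of a real family over a finite index type — the norm of p38's adjoint carrier
`PiLp 1 (ι → ℝ)` read on the underlying function (`B5SupCarrierTorus.norm_V1`). [cite: Balaban1984PropagatorsI, p.39 L7–9 (the adjoint
representation), (1.108) p.35] -/
def l1 (v : ι → ℝ) : ℝ := ∑ i, |v i|

/-- `l1` unfolds. [cite: Balaban1984PropagatorsI, p.39 L7–9] -/
theorem l1_apply (v : ι → ℝ) : l1 v = ∑ i, |v i| := rfl

/-- `0 ≤ l1 v`. [cite: Balaban1984PropagatorsI, p.39 L7–9] -/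
theorem l1_nonneg (v : ι → ℝ) : 0 ≤ l1 v := Finset.sum_nonneg fun _ _ => abs_nonneg _

/-- `l1 0 = 0`. [cite: Balaban1984PropagatorsI, p.39 L7–9] -/
theorem l1_zero : l1 (0 : ι → ℝ) = 0 := by
  simp [l1]

/-- triangle inequality `l1 (v + w) ≤ l1 v + l1 w`. [cite: Balaban1984PropagatorsI, p.39 L7–9] -/
theorem l1_add_le (v w : ι → ℝ) : l1 (v + w) ≤ l1 v + l1 w := by
  unfold l1
  rw [← Finset.sum_add_distrib]
  exact Finset.sum_le_sum fun i _ => abs_add_le (v i) (w i)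

/-- a multiplier bounded by `C` contracts `l1` by `C`: `l1 (mulOpS a v) ≤ C·l1 v` (the `ℓ¹` reading of `|h_zA| ≤ |A|`).
[cite: Balaban1984PropagatorsI, (1.118) p.36, p.39 L7–9] -/
theorem l1_mulOpS_le {a : ι → ℝ} {C : ℝ} (ha : ∀ i, |a i| ≤ C) (v : ι → ℝ) : l1 (mulOpS a v) ≤ C * l1 v := by
  unfold l1
  rw [Finset.mul_sum]
  refine Finset.sum_le_sum fun i _ => ?_
  rw [mulOpS_apply, abs_mul]
  exact mul_le_mul_of_nonneg_right (ha i) (abs_nonneg _)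

/-- pointwise product form of `l1_mulOpS_le`: `|g| ≤ c ⇒ l1 (g·u) ≤ c·l1 u`. [cite: Balaban1984PropagatorsI, (1.121) p.37, p.39 L7–9] -/
theorem l1_mul_le {g u : ι → ℝ} {c : ℝ} (hg : ∀ i, |g i| ≤ c) : l1 (fun i => g i * u i) ≤ c * l1 u := by
  unfold l1
  rw [Finset.mul_sum]
  refine Finset.sum_le_sum fun i _ => ?_
  rw [abs_mul]
  exact mul_le_mul_of_nonneg_right (hg i) (abs_nonneg _)

/-- `l1 (c·u) = |c|·l1 u`. [cite: Balaban1984PropagatorsI, p.39 L7–9] -/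
theorem l1_const_mul (c : ℝ) (u : ι → ℝ) : l1 (fun i => c * u i) = |c| * l1 u := by
  unfold l1
  rw [Finset.mul_sum]
  exact Finset.sum_congr rfl fun i _ => abs_mul _ _

/-- `l1 (u ∘ σ) = l1 u` for a bijection `σ` (translation invariance of sums over the torus). [cite: Balaban1984PropagatorsI, (1.21) p.21,
p.39 L7–9] -/
theorem l1_comp_equiv (σ : ι ≃ ι) (u : ι → ℝ) : l1 (fun i => u (σ i)) = l1 u := by
  unfold l1
  exact Fintype.sum_equiv σ (fun i => |u (σ i)|) (fun i => |u i|) fun _ => rfl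

/-- `l1 (Σ_s u_s) ≤ Σ_s l1 (u_s)`. [cite: Balaban1984PropagatorsI, p.39 L7–9] -/
theorem l1_sum_le {κ : Type*} (s : Finset κ) (u : κ → ι → ℝ) : l1 (∑ k ∈ s, u k) ≤ ∑ k ∈ s, l1 (u k) := by
  classical
  induction s using Finset.induction_on with
  | empty => simp [l1_zero]
  | insert a s ha ih =>
    rw [Finset.sum_insert ha, Finset.sum_insert ha]
    exact (l1_add_le _ _).trans (add_le_add le_rfl ih)

end L1

/-! ## §2  The `ℓ¹ → ℓ¹` bound of a kernel operator from column sums -/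

section ColumnSum

variable {ι : Type} [Fintype ι]

/-- **Column-sum bound** (the `ℓ¹ → ℓ¹` norm of a kernel operator is the maximal absolute COLUMN sum — the `ℓ^∞` norm of the
transposed kernel): if every absolute column sum of `k` is `≤ R`, then `l1 (kerOpS k v) ≤ R·l1 v` (folklore; the `ℓ¹` twin of own
`B5SupCommutator128.norm_kerOpS_le`). [cite: Balaban1984PropagatorsI, (1.126) p.38, p.39 L7–9] -/
theorem l1_kerOpS_le {k : ι → ι → ℝ} {R : ℝ} (hR : ∀ j, ∑ i, |k i j| ≤ R) (v : ι → ℝ) :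
    l1 (kerOpS k v) ≤ R * l1 v := by
  unfold l1
  calc ∑ i, |kerOpS k v i| = ∑ i, |∑ j, k i j * v j| := by simp only [kerOpS_apply]
    _ ≤ ∑ i, ∑ j, |k i j| * |v j| :=
        Finset.sum_le_sum fun i _ =>
          (Finset.abs_sum_le_sum_abs _ _).trans (le_of_eq (Finset.sum_congr rfl fun j _ => abs_mul _ _))
    _ = ∑ j, (∑ i, |k i j|) * |v j| := by
        rw [Finset.sum_comm]
        exact Finset.sum_congr rfl fun j _ => by rw [Finset.sum_mul]
    _ ≤ ∑ j, R * |v j| := Finset.sum_le_sum fun j _ => mul_le_mul_of_nonneg_right (hR j) (abs_nonneg _)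
    _ = R * ∑ j, |v j| := by rw [Finset.mul_sum]

variable {X : Type} [PseudoMetricSpace X]

/-- **Column-sum bound, decay form**: `|k_ij| ≤ B e^{−β dist(π i, π j)}` (`B ≥ 0`) and uniform ROW sums `Σ_j e^{−β dist(π i, π j)} ≤ Λ`
give `l1 (kerOpS k v) ≤ BΛ·l1 v` — the column sums of the symmetric majorant are row sums (folklore; the way (1.126) is used for (1.128) on
the adjoint side). [cite: Balaban1984PropagatorsI, (1.126), (1.128) p.38, p.39 L7–9] -/
theorem l1_kerOpS_le_of_decay (π : ι → X) {k : ι → ι → ℝ} {B β Λ : ℝ} (hB : 0 ≤ B)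
    (hk : ∀ i j, |k i j| ≤ B * Real.exp (-(β * dist (π i) (π j))))
    (hΛ : ∀ i, ∑ j, Real.exp (-(β * dist (π i) (π j))) ≤ Λ) (v : ι → ℝ) :
    l1 (kerOpS k v) ≤ B * Λ * l1 v := by
  have hcol : ∀ j, ∑ i, |k i j| ≤ B * Λ := by
    intro j
    calc ∑ i, |k i j| ≤ ∑ i, B * Real.exp (-(β * dist (π i) (π j))) := Finset.sum_le_sum fun i _ => hk i j
      _ = B * ∑ i, Real.exp (-(β * dist (π j) (π i))) := by
          rw [Finset.mul_sum]
          exact Finset.sum_congr rfl fun i _ => by rw [dist_comm]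
      _ ≤ B * Λ := mul_le_mul_of_nonneg_left (hΛ j) hB
  exact l1_kerOpS_le hcol v

/-- **Column-sum bound, transposed decay form**: an entrywise majorant read at `(j, i)`, `|k_ij| ≤ B e^{−β dist(π j, π i)}`, gives the same
bound `l1 (kerOpS k v) ≤ BΛ·l1 v` (folklore). [cite: Balaban1984PropagatorsI, (1.126), (1.128) p.38, p.39 L7–9] -/
theorem l1_kerOpS_le_of_decay' (π : ι → X) {k : ι → ι → ℝ} {B β Λ : ℝ} (hB : 0 ≤ B)
    (hk : ∀ i j, |k i j| ≤ B * Real.exp (-(β * dist (π j) (π i))))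
    (hΛ : ∀ i, ∑ j, Real.exp (-(β * dist (π i) (π j))) ≤ Λ) (v : ι → ℝ) :
    l1 (kerOpS k v) ≤ B * Λ * l1 v :=
  l1_kerOpS_le_of_decay π hB (fun i j => by rw [dist_comm]; exact hk i j) hΛ v

end ColumnSum

/-! ## §3  The kernel part of (1.128) in `ℓ¹` -/

section KernelPart

variable {ι : Type} [Fintype ι] {X : Type} [PseudoMetricSpace X]

/-- **The kernel part of (1.128), multiplier on the left, `ℓ¹` size**: with `|a₁| ≤ 1` supported in the `s`-ball of `c₁`, `a₂`
`ℓ`-Lipschitz along `π` (`ℓ ≥ 0`) supported in the `s`-ball of `c₂`, `|k_ij| ≤ C e^{−δ dist(π i, π j)}` and uniform row sums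
`Σ_j e^{−(δ/8)dist(π i, π j)} ≤ Λ`: `l1 (mulOpS a₁ ([mulOpS a₂, kerOpS k] v)) ≤ ℓ·C·(24/(eδ))·Λ·e^{−(5δ/6)(dist(c₁,c₂) − 2s)⁺}·l1 v` —
b05's entry majorant `entry_three_le` read through the column-sum bound; same constant as the `ℓ^∞` twin `norm_three_kernel_leS`.
[cite: Balaban1984PropagatorsI, p.38 before (1.128), p.39 L7–9] -/
theorem l1_three_kernel_le (π : ι → X) {a₁ a₂ : ι → ℝ} {c₁ c₂ : X} {s ℓ C δ Λ : ℝ} {k : ι → ι → ℝ}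
    (hδ : 0 < δ) (hC : 0 ≤ C) (hℓ : 0 ≤ ℓ)
    (hb : ∀ i, |a₁ i| ≤ 1) (h₁ : ∀ i, a₁ i ≠ 0 → dist (π i) c₁ ≤ s)
    (h₂ : ∀ j, a₂ j ≠ 0 → dist (π j) c₂ ≤ s) (hlip : ∀ i j, |a₂ i - a₂ j| ≤ ℓ * dist (π i) (π j))
    (hk : ∀ i j, |k i j| ≤ C * Real.exp (-(δ * dist (π i) (π j))))
    (hΛ : ∀ i, ∑ j, Real.exp (-(δ / 8 * dist (π i) (π j))) ≤ Λ) (v : ι → ℝ) :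
    l1 (mulOpS a₁ ((mulOpS a₂ * kerOpS k - kerOpS k * mulOpS a₂) v))
      ≤ ℓ * C * (24 / (Real.exp 1 * δ)) * Λ * Real.exp (-(5 * δ / 6 * max 0 (dist c₁ c₂ - 2 * s)))
        * l1 v := by
  have e : mulOpS a₁ ((mulOpS a₂ * kerOpS k - kerOpS k * mulOpS a₂) v)
      = (mulOpS a₁ * (mulOpS a₂ * kerOpS k - kerOpS k * mulOpS a₂)) v := rfl
  rw [e, three_eq_kerOpS]
  have B0 : 0 ≤ ℓ * C * (24 / (Real.exp 1 * δ)) * Real.exp (-(5 * δ / 6 * max 0 (dist c₁ c₂ - 2 * s))) := by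
    positivity
  have main := l1_kerOpS_le_of_decay π B0 (fun i j => entry_three_le π hδ hC hℓ hb h₁ h₂ hlip hk i j) hΛ v
  calc _ ≤ _ := main
    _ = _ := by ring

/-- **The kernel part of (1.128), multiplier on the right, `ℓ¹` size** («with the operators K(h) acting on the right», p. 39): under the
hypotheses of `l1_three_kernel_le`, `l1 ([mulOpS a₂, kerOpS k] (mulOpS a₁ v)) ≤ ℓ·C·(24/(eδ))·Λ·e^{−(5δ/6)(dist(c₁,c₂) − 2s)⁺}·l1 v` (the
entry `(a₂ i − a₂ j)k_ij a₁ j` is b05's entry for the transposed kernel; the column sums of the symmetric majorant are again `≤ Λ`).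
[cite: Balaban1984PropagatorsI, p.38 before (1.128), p.39 L7–9] -/
theorem l1_kernel_three_le (π : ι → X) {a₁ a₂ : ι → ℝ} {c₁ c₂ : X} {s ℓ C δ Λ : ℝ} {k : ι → ι → ℝ}
    (hδ : 0 < δ) (hC : 0 ≤ C) (hℓ : 0 ≤ ℓ)
    (hb : ∀ i, |a₁ i| ≤ 1) (h₁ : ∀ i, a₁ i ≠ 0 → dist (π i) c₁ ≤ s)
    (h₂ : ∀ j, a₂ j ≠ 0 → dist (π j) c₂ ≤ s) (hlip : ∀ i j, |a₂ i - a₂ j| ≤ ℓ * dist (π i) (π j))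
    (hk : ∀ i j, |k i j| ≤ C * Real.exp (-(δ * dist (π i) (π j))))
    (hΛ : ∀ i, ∑ j, Real.exp (-(δ / 8 * dist (π i) (π j))) ≤ Λ) (v : ι → ℝ) :
    l1 ((mulOpS a₂ * kerOpS k - kerOpS k * mulOpS a₂) (mulOpS a₁ v))
      ≤ ℓ * C * (24 / (Real.exp 1 * δ)) * Λ * Real.exp (-(5 * δ / 6 * max 0 (dist c₁ c₂ - 2 * s)))
        * l1 v := by
  have e : (mulOpS a₂ * kerOpS k - kerOpS k * mulOpS a₂) (mulOpS a₁ v)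
      = ((mulOpS a₂ * kerOpS k - kerOpS k * mulOpS a₂) * mulOpS a₁) v := rfl
  rw [e, comm_mul_mulOpS_eq_kerOpS]
  have B0 : 0 ≤ ℓ * C * (24 / (Real.exp 1 * δ)) * Real.exp (-(5 * δ / 6 * max 0 (dist c₁ c₂ - 2 * s))) := by
    positivity
  -- the transposed kernel obeys the same decay bound
  have hkT : ∀ i j, |(fun i j => k j i) i j| ≤ C * Real.exp (-(δ * dist (π i) (π j))) := by
    intro i j
    show |k j i| ≤ _
    rw [dist_comm]
    exact hk j i
  have hent : ∀ i j, |(a₂ i - a₂ j) * k i j * a₁ j|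
      ≤ ℓ * C * (24 / (Real.exp 1 * δ)) * Real.exp (-(5 * δ / 6 * max 0 (dist c₁ c₂ - 2 * s)))
        * Real.exp (-(δ / 8 * dist (π j) (π i))) := by
    intro i j
    have h := entry_three_le π hδ hC hℓ hb h₁ h₂ hlip hkT j i
    have e2 : (a₂ i - a₂ j) * k i j * a₁ j = -(a₁ j * ((a₂ j - a₂ i) * (fun i j => k j i) j i)) := by
      show (a₂ i - a₂ j) * k i j * a₁ j = -(a₁ j * ((a₂ j - a₂ i) * k i j))
      ring
    rw [e2, abs_neg]
    exact h
  have main := l1_kerOpS_le_of_decay' π B0 hent hΛ v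
  calc _ ≤ _ := main
    _ = _ := by ring

/-- **The unpaired form in `ℓ¹`** («In the second case we have the small factor O(M₀⁻¹) only»): for an `ℓ`-Lipschitz multiplier and
`|k_ij| ≤ C e^{−δ dist}`, `l1 ([mulOpS a, kerOpS k] v) ≤ ℓ·C·(2/(eδ))·Λ′·l1 v` with `Λ′` the row-sum bound at rate `δ/2`.
[cite: Balaban1984PropagatorsI, p.38 before (1.128), p.39 L7–9] -/
theorem l1_comm_kernel_le (π : ι → X) {a : ι → ℝ} {ℓ C δ Λ' : ℝ} {k : ι → ι → ℝ}
    (hδ : 0 < δ) (hC : 0 ≤ C) (hℓ : 0 ≤ ℓ) (hlip : ∀ i j, |a i - a j| ≤ ℓ * dist (π i) (π j))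
    (hk : ∀ i j, |k i j| ≤ C * Real.exp (-(δ * dist (π i) (π j))))
    (hΛ : ∀ i, ∑ j, Real.exp (-(δ / 2 * dist (π i) (π j))) ≤ Λ') (v : ι → ℝ) :
    l1 ((mulOpS a * kerOpS k - kerOpS k * mulOpS a) v) ≤ ℓ * C * (2 / (Real.exp 1 * δ)) * Λ' * l1 v := by
  rw [comm_mulOpS_kerOpS]
  have B0 : 0 ≤ ℓ * C * (2 / (Real.exp 1 * δ)) := by positivity
  have hent : ∀ i j, |(a i - a j) * k i j|
      ≤ ℓ * C * (2 / (Real.exp 1 * δ)) * Real.exp (-(δ / 2 * dist (π i) (π j))) := by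
    intro i j
    rw [abs_mul]
    have ht0 : 0 ≤ dist (π i) (π j) := dist_nonneg
    calc |a i - a j| * |k i j|
        ≤ (ℓ * dist (π i) (π j)) * (C * Real.exp (-(δ * dist (π i) (π j)))) :=
          mul_le_mul (hlip i j) (hk i j) (abs_nonneg _) (by positivity)
      _ = ℓ * C * (dist (π i) (π j) * Real.exp (-(δ * dist (π i) (π j)))) := by ring
      _ ≤ ℓ * C * (2 / (Real.exp 1 * δ) * Real.exp (-(δ / 2 * dist (π i) (π j)))) :=
          mul_le_mul_of_nonneg_left (mul_exp_half hδ _) (by positivity)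
      _ = _ := by ring
  exact l1_kerOpS_le_of_decay π B0 hent hΛ v

end KernelPart

/-! ## §4–§5  The `ℓ¹` schema and its assembly in the shape of `B5SupWalkS1.Rep.h128` -/

section Assembly

variable {ι : Type} [Fintype ι] {X : Type} [PseudoMetricSpace X]

/-- **The hypotheses of the `ℓ¹` schema** for `Δa = kerOpS l + kerOpS k`, `H z = mulOpS (a z)`, with a nonnegative size functional
`N : (ι → ℝ) → ℝ` (model: the `ℓ¹` size of the gradient, `Σ_{ν,b} |(∇_ν A)(b)|`): profiles bounded by `1`, supported in `s`-balls around the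
centres `c z`, `ℓ`-Lipschitz along `π`; a finite-range part `l` (range `ρ`) whose commutators with the `H z` obey the NORMED LOCAL HYPOTHESIS
IN `ℓ¹` `l1 ([H z, kerOpS l] A) ≤ ℓ₁(N A + l1 A)` (the (1.121) computation summed over the torus — NOT discharged in this module); a kernel
part `k` with `|k_ij| ≤ C e^{−δ dist(π i, π j)}` (the role of (1.126)) and uniform row sums `Λ ≥ 0` at rate `δ/8` — own `SchemaS` with the
size read in `ℓ¹`. [cite: Balaban1984PropagatorsI, (1.121) p.37, (1.126) p.38, p.39 L7–9] -/
structure SchemaOne (π : ι → X) {S : Type} (a : S → ι → ℝ) (c : S → X) (l k : ι → ι → ℝ)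
    (N : (ι → ℝ) → ℝ) (s ℓ ℓ₁ ρ C δ Λ : ℝ) : Prop where
  /-- `|a z i| ≤ 1` -/
  abs_le : ∀ z i, |a z i| ≤ 1
  /-- `a z` is supported in the `s`-ball of `c z` -/
  supp : ∀ z i, a z i ≠ 0 → dist (π i) (c z) ≤ s
  /-- `a z` is `ℓ`-Lipschitz along `π` -/
  lip : ∀ z i j, |a z i - a z j| ≤ ℓ * dist (π i) (π j)
  /-- `0 ≤ ℓ` -/
  lip_nonneg : 0 ≤ ℓ
  /-- `l` has range `ρ` -/
  range : ∀ i j, ρ < dist (π i) (π j) → l i j = 0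
  /-- the normed local hypothesis in `ℓ¹` (the (1.121) computation summed over the sites, NOT discharged here) -/
  local_l1 : ∀ z A, l1 ((mulOpS (a z) * kerOpS l - kerOpS l * mulOpS (a z)) A) ≤ ℓ₁ * (N A + l1 A)
  /-- the size functional is nonnegative -/
  N_nonneg : ∀ A, 0 ≤ N A
  /-- `0 ≤ ℓ₁` -/
  loc_nonneg : 0 ≤ ℓ₁
  /-- `|k_ij| ≤ C e^{−δ dist(π i, π j)}` (the role of (1.126)) -/
  decay : ∀ i j, |k i j| ≤ C * Real.exp (-(δ * dist (π i) (π j)))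
  /-- `0 ≤ C` -/
  C_nonneg : 0 ≤ C
  /-- `0 < δ` -/
  δ_pos : 0 < δ
  /-- uniform row sums at rate `δ/8` (= column sums, by the symmetry of `dist`) -/
  rowsum : ∀ i, ∑ j, Real.exp (-(δ / 8 * dist (π i) (π j))) ≤ Λ
  /-- `0 ≤ Λ` (needed only when `ι` is empty, where `rowsum` is vacuous and `N` arbitrary) -/
  Λ_nonneg : 0 ≤ Λ

/-- **The `ℓ¹` schema of (1.126) ⟹ (1.128)**: under `SchemaOne`, `0 < M₀` and `s ≤ 2M₀`,
`l1 (H z₁ (Kop Δa H z₂ A)) ≤ (ℓ₁·e^{4+ρ/M₀} + ℓ·C·(24/(eδ))·Λ·e^7)·e^{−twoDelta0 δ M₀·dist(c z₁, c z₂)}·(N A + l1 A)` for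
`Δa = kerOpS l + kerOpS k`, `H z = mulOpS (a z)` — the statement shape of own `h128_schemaS` with the sizes read in `ℓ¹` (hence of the field
`h128` of `B5SupWalkS1.Rep` on p38's adjoint carrier `V1`, `2δ₀ = twoDelta0 δ′₀ M₀ = min{⅓δ′₀, M₀⁻¹}`), constant of order `M₀⁻¹` as soon as
`ℓ, ℓ₁ = O(M₀⁻¹)`.  Local part: hypothesis `local_l1` + proved locality `three_local_eq_zeroS`; kernel part: `l1_three_kernel_le` + b05's
`exp_sep_le`. [cite: Balaban1984PropagatorsI, (1.128) p.38, p.39 L7–9] -/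
theorem h128_schemaOne {π : ι → X} {S : Type} {a : S → ι → ℝ} {c : S → X} {l k : ι → ι → ℝ}
    {N : (ι → ℝ) → ℝ} {s ℓ ℓ₁ ρ C δ Λ : ℝ}
    (hS : SchemaOne π a c l k N s ℓ ℓ₁ ρ C δ Λ) {M₀ : ℝ} (hM : 0 < M₀) (hs : s ≤ 2 * M₀)
    (z₁ z₂ : S) (A : ι → ℝ) :
    l1 (mulOpS (a z₁) (Kop (kerOpS l + kerOpS k) (fun z => mulOpS (a z)) z₂ A))
      ≤ (ℓ₁ * Real.exp (4 + ρ / M₀) + ℓ * C * (24 / (Real.exp 1 * δ)) * Λ * Real.exp 7)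
        * Real.exp (-(twoDelta0 δ M₀ * dist (c z₁) (c z₂))) * (N A + l1 A) := by
  have hT0 : 0 ≤ dist (c z₁) (c z₂) := dist_nonneg
  have hE0 : 0 < Real.exp (-(twoDelta0 δ M₀ * dist (c z₁) (c z₂))) := Real.exp_pos _
  have hδ := hS.δ_pos
  have hC := hS.C_nonneg
  have hℓ := hS.lip_nonneg
  have hℓ₁ := hS.loc_nonneg
  have hN := hS.N_nonneg A
  have hA := l1_nonneg A
  have hΛ := hS.Λ_nonneg
  rw [Kop_add, LinearMap.add_apply, map_add]
  -- the local term
  have hloc : l1 (mulOpS (a z₁) (Kop (kerOpS l) (fun z => mulOpS (a z)) z₂ A))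
      ≤ ℓ₁ * Real.exp (4 + ρ / M₀) * Real.exp (-(twoDelta0 δ M₀ * dist (c z₁) (c z₂))) * (N A + l1 A) := by
    rcases lt_or_ge (2 * s + ρ) (dist (c z₁) (c z₂)) with hfar | hnear
    · have h0 : mulOpS (a z₁) * (mulOpS (a z₂) * kerOpS l - kerOpS l * mulOpS (a z₂)) = 0 :=
        three_local_eq_zeroS π (hS.supp z₁) (hS.supp z₂) hS.range hfar
      have : mulOpS (a z₁) (Kop (kerOpS l) (fun z => mulOpS (a z)) z₂ A) = 0 := by
        have e : mulOpS (a z₁) (Kop (kerOpS l) (fun z => mulOpS (a z)) z₂ A)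
            = (mulOpS (a z₁) * (mulOpS (a z₂) * kerOpS l - kerOpS l * mulOpS (a z₂))) A := rfl
        rw [e, h0, LinearMap.zero_apply]
      rw [this, l1_zero]
      positivity
    · have h1 : l1 (mulOpS (a z₁) (Kop (kerOpS l) (fun z => mulOpS (a z)) z₂ A))
          ≤ 1 * l1 (Kop (kerOpS l) (fun z => mulOpS (a z)) z₂ A) := l1_mulOpS_le (hS.abs_le z₁) _
      have h2 : l1 (Kop (kerOpS l) (fun z => mulOpS (a z)) z₂ A) ≤ ℓ₁ * (N A + l1 A) := hS.local_l1 z₂ A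
      have h3 : 1 ≤ Real.exp (4 + ρ / M₀) * Real.exp (-(twoDelta0 δ M₀ * dist (c z₁) (c z₂))) :=
        one_le_exp_local hM hs hT0 hnear
      have hn0 : 0 ≤ N A + l1 A := by positivity
      calc l1 (mulOpS (a z₁) (Kop (kerOpS l) (fun z => mulOpS (a z)) z₂ A))
          ≤ ℓ₁ * (N A + l1 A) := by rw [one_mul] at h1; exact h1.trans h2
        _ = ℓ₁ * (N A + l1 A) * 1 := by ring
        _ ≤ ℓ₁ * (N A + l1 A)
              * (Real.exp (4 + ρ / M₀) * Real.exp (-(twoDelta0 δ M₀ * dist (c z₁) (c z₂)))) :=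
            mul_le_mul_of_nonneg_left h3 (by positivity)
        _ = _ := by ring
  -- the kernel term
  have hker : l1 (mulOpS (a z₁) (Kop (kerOpS k) (fun z => mulOpS (a z)) z₂ A))
      ≤ ℓ * C * (24 / (Real.exp 1 * δ)) * Λ * Real.exp 7
        * Real.exp (-(twoDelta0 δ M₀ * dist (c z₁) (c z₂))) * (N A + l1 A) := by
    have h1 := l1_three_kernel_le π hδ hC hℓ (hS.abs_le z₁) (hS.supp z₁) (hS.supp z₂) (hS.lip z₂)
      hS.decay hS.rowsum A
    have h2 := exp_sep_le hδ hM hs hT0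
    have hA' : l1 A ≤ N A + l1 A := le_add_of_nonneg_left hN
    have e : mulOpS (a z₁) (Kop (kerOpS k) (fun z => mulOpS (a z)) z₂ A)
        = mulOpS (a z₁) ((mulOpS (a z₂) * kerOpS k - kerOpS k * mulOpS (a z₂)) A) := rfl
    rw [e]
    calc _ ≤ ℓ * C * (24 / (Real.exp 1 * δ)) * Λ * Real.exp (-(5 * δ / 6 * max 0 (dist (c z₁) (c z₂) - 2 * s)))
          * l1 A := h1
      _ ≤ ℓ * C * (24 / (Real.exp 1 * δ)) * Λ
          * (Real.exp 7 * Real.exp (-(twoDelta0 δ M₀ * dist (c z₁) (c z₂)))) * (N A + l1 A) := by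
          apply mul_le_mul _ hA' hA (by positivity)
          exact mul_le_mul_of_nonneg_left h2 (by positivity)
      _ = _ := by ring
  calc l1 (mulOpS (a z₁) (Kop (kerOpS l) (fun z => mulOpS (a z)) z₂ A)
        + mulOpS (a z₁) (Kop (kerOpS k) (fun z => mulOpS (a z)) z₂ A))
      ≤ l1 (mulOpS (a z₁) (Kop (kerOpS l) (fun z => mulOpS (a z)) z₂ A))
        + l1 (mulOpS (a z₁) (Kop (kerOpS k) (fun z => mulOpS (a z)) z₂ A)) := l1_add_le _ _
    _ ≤ _ := add_le_add hloc hker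
    _ = _ := by ring

/-- **The kernel term with the multiplier on the right, `ℓ¹` size, in `h128` units**: under `SchemaOne`, `0 < M₀`, `s ≤ 2M₀`,
`l1 ((Kop (kerOpS k) H z₂) (H z₁ A)) ≤ ℓ·C·(24/(eδ))·Λ·e^7·e^{−twoDelta0 δ M₀·dist(c z₁, c z₂)}·l1 A`.
[cite: Balaban1984PropagatorsI, (1.128) p.38, p.39 L7–9] -/
theorem kernel_right_l1_le {π : ι → X} {S : Type} {a : S → ι → ℝ} {c : S → X} {l k : ι → ι → ℝ}
    {N : (ι → ℝ) → ℝ} {s ℓ ℓ₁ ρ C δ Λ : ℝ}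
    (hS : SchemaOne π a c l k N s ℓ ℓ₁ ρ C δ Λ) {M₀ : ℝ} (hM : 0 < M₀) (hs : s ≤ 2 * M₀)
    (z₁ z₂ : S) (A : ι → ℝ) :
    l1 (Kop (kerOpS k) (fun z => mulOpS (a z)) z₂ (mulOpS (a z₁) A))
      ≤ ℓ * C * (24 / (Real.exp 1 * δ)) * Λ * Real.exp 7
        * Real.exp (-(twoDelta0 δ M₀ * dist (c z₁) (c z₂))) * l1 A := by
  have hT0 : 0 ≤ dist (c z₁) (c z₂) := dist_nonneg
  have hδ := hS.δ_pos
  have hC := hS.C_nonneg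
  have hℓ := hS.lip_nonneg
  have hA := l1_nonneg A
  have hΛ := hS.Λ_nonneg
  have h1 := l1_kernel_three_le π hδ hC hℓ (hS.abs_le z₁) (hS.supp z₁) (hS.supp z₂) (hS.lip z₂)
    hS.decay hS.rowsum A
  have h2 := exp_sep_le hδ hM hs hT0
  have e : Kop (kerOpS k) (fun z => mulOpS (a z)) z₂ (mulOpS (a z₁) A)
      = (mulOpS (a z₂) * kerOpS k - kerOpS k * mulOpS (a z₂)) (mulOpS (a z₁) A) := rfl
  rw [e]
  calc _ ≤ ℓ * C * (24 / (Real.exp 1 * δ)) * Λ * Real.exp (-(5 * δ / 6 * max 0 (dist (c z₁) (c z₂) - 2 * s)))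
        * l1 A := h1
    _ ≤ ℓ * C * (24 / (Real.exp 1 * δ)) * Λ
        * (Real.exp 7 * Real.exp (-(twoDelta0 δ M₀ * dist (c z₁) (c z₂)))) * l1 A := by
        apply mul_le_mul_of_nonneg_right _ hA
        exact mul_le_mul_of_nonneg_left h2 (by positivity)
    _ = _ := by ring

end Assembly


/-! # PART B — the operators of record on the adjoint carrier (the twin of `B5SupRepTorus`) -/
variable {d : ℕ}

/-! ## §1 The (1.121) local bound in `ℓ¹` -/

section Local

variable {n : ℕ} [NeZero n] {M : Fin d → ℕ} [hM : ∀ μ, NeZero (M μ)] {M₀ : ℕ} {a : ℝ}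

omit [NeZero n] hM in
/-- p38 gen 8's multiplier profile `hcoefS` IS p38 gen 7's `gz`; private bridge. [cite: Balaban1984PropagatorsI, (1.118) p.36] -/
private theorem hcoefS_eq_gz (z : Cen M M₀) : hcoefS n M M₀ z = gz n M M₀ z := rfl

/-- **translation invariance**: `Σ_b |(∇_νᵀ v)(b)| = Σ_b |(∇_ν v)(b)|` (`(∇ᵀ_ν v)(b + e_ν) = −(∇_ν v)(b)`).
[cite: Balaban1984PropagatorsI, (1.21) p.21, (1.121) p.37] -/
theorem l1_fdiffR_transpose_eq (ν : Fin d) (v : Bnd n M → ℝ) : l1 ((fdiffR n M ν)ᵀ *ᵥ v) = l1 (fdiffR n M ν *ᵥ v) := by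
  unfold l1
  refine (Fintype.sum_equiv (nbEquiv (n := n) (M := M) ν) _ _ fun b => ?_).symm
  rw [fdiffR_mulVec_apply, show (nbEquiv (n := n) (M := M) ν) b = nb n M ν b from rfl, fdiffR_transpose_mulVec_apply, pb_nb,
    abs_eq_abs]
  right
  ring

/-- `Σ|(∇_ν h_z)(∇_ν v)| ≤ (Lw/M₀)·Σ|∇_ν v|`. [cite: Balaban1984PropagatorsI, (1.121) p.37, (1.128) p.38] -/
theorem l1_piece1_le (hn : 1 ≤ n) (hM₀ : 1 ≤ M₀) (z : Cen M M₀) (ν : Fin d) (v : Bnd n M → ℝ) :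
    l1 (piece1 (gz n M M₀ z) v ν) ≤ Lw d / M₀ * l1 (fdiffR n M ν *ᵥ v) := by
  have hnpos : (0 : ℝ) < n := Nat.cast_pos.mpr (NeZero.pos n)
  refine l1_mul_le fun b => ?_
  rw [abs_mul, abs_of_pos hnpos]
  calc (n : ℝ) * |gz n M M₀ z (nb n M ν b) - gz n M M₀ z b| ≤ n * (Lw d / M₀ * (1 / n)) :=
        mul_le_mul_of_nonneg_left (abs_gz_nb_sub_le hn hM₀ z ν b) hnpos.le
    _ = Lw d / M₀ := by field_simp

/-- `Σ|(∇_νᵀ h_z)(∇_νᵀ v)| ≤ (Lw/M₀)·Σ|∇_ν v|`. [cite: Balaban1984PropagatorsI, (1.121) p.37, (1.128) p.38] -/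
theorem l1_piece2_le (hn : 1 ≤ n) (hM₀ : 1 ≤ M₀) (z : Cen M M₀) (ν : Fin d) (v : Bnd n M → ℝ) :
    l1 (piece2 (gz n M M₀ z) v ν) ≤ Lw d / M₀ * l1 (fdiffR n M ν *ᵥ v) := by
  have hnpos : (0 : ℝ) < n := Nat.cast_pos.mpr (NeZero.pos n)
  rw [← l1_fdiffR_transpose_eq]
  refine l1_mul_le fun b => ?_
  rw [abs_mul, abs_of_pos hnpos]
  calc (n : ℝ) * |gz n M M₀ z (pb n M ν b) - gz n M M₀ z b| ≤ n * (Lw d / M₀ * (1 / n)) :=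
        mul_le_mul_of_nonneg_left (abs_gz_pb_sub_le hn hM₀ z ν b) hnpos.le
    _ = Lw d / M₀ := by field_simp

/-- `Σ|(Δ_ν h_z)·v| ≤ (K2/M₀²)·Σ|v|`. [cite: Balaban1984PropagatorsI, (1.121) p.37 («(Δh)A»)] -/
theorem l1_piece3_le (hM₀ : 1 ≤ M₀) (z : Cen M M₀) (ν : Fin d) (v : Bnd n M → ℝ) :
    l1 (piece3 (gz n M M₀ z) v ν) ≤ K2 / (M₀ : ℝ) ^ 2 * l1 v := by
  refine l1_mul_le fun b => ?_
  rw [abs_mul, abs_of_nonneg (by positivity : (0 : ℝ) ≤ (n : ℝ) ^ 2)]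
  calc (n : ℝ) ^ 2 * |gz n M M₀ z (nb n M ν b) - 2 * gz n M M₀ z b + gz n M M₀ z (pb n M ν b)|
      ≤ (n : ℝ) ^ 2 * (K2 / (M₀ : ℝ) ^ 2 * (1 / n) ^ 2) :=
        mul_le_mul_of_nonneg_left (abs_gz_second_diff_le hM₀ z ν b) (by positivity)
    _ = K2 / (M₀ : ℝ) ^ 2 := by
        have hn0 : (n : ℝ) ≠ 0 := Nat.cast_ne_zero.mpr (NeZero.ne n)
        field_simp

/-- **THE LAPLACIAN PART OF THE LOCAL BOUND IN `ℓ¹`, ONE AXIS**: `Σ_b |[h_z, ∇_νᵀ∇_ν]v(b)| ≤ 2(Lw/M₀)·Σ|∇_ν v| + (K2/M₀²)·Σ|v|`.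
[cite: Balaban1984PropagatorsI, (1.121) p.37, (1.128) p.38, p.39 L7–9] -/
theorem l1_commR_axis_le (hn : 1 ≤ n) (hM₀ : 1 ≤ M₀) (z : Cen M M₀) (ν : Fin d) (v : Bnd n M → ℝ) :
    l1 (commR (gz n M M₀ z) ((fdiffR n M ν)ᵀ * fdiffR n M ν) v)
      ≤ 2 * (Lw d / M₀) * l1 (fdiffR n M ν *ᵥ v) + K2 / (M₀ : ℝ) ^ 2 * l1 v := by
  have h1 := l1_piece1_le hn hM₀ z ν v
  have h2 := l1_piece2_le hn hM₀ z ν v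
  have h3 := l1_piece3_le (n := n) hM₀ z ν v
  have h12 := l1_add_le (piece1 (gz n M M₀ z) v ν) (piece2 (gz n M M₀ z) v ν)
  have h123 := l1_add_le (piece1 (gz n M M₀ z) v ν + piece2 (gz n M M₀ z) v ν) (piece3 (gz n M M₀ z) v ν)
  calc l1 (commR (gz n M M₀ z) ((fdiffR n M ν)ᵀ * fdiffR n M ν) v)
      = l1 (piece1 (gz n M M₀ z) v ν + piece2 (gz n M M₀ z) v ν + piece3 (gz n M M₀ z) v ν) :=
        congrArg l1 (commR_axis_eq (gz n M M₀ z) v ν)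
    _ ≤ l1 (piece1 (gz n M M₀ z) v ν) + l1 (piece2 (gz n M M₀ z) v ν) + l1 (piece3 (gz n M M₀ z) v ν) := by linarith
    _ ≤ Lw d / M₀ * l1 (fdiffR n M ν *ᵥ v) + Lw d / M₀ * l1 (fdiffR n M ν *ᵥ v) + K2 / (M₀ : ℝ) ^ 2 * l1 v :=
        add_le_add (add_le_add h1 h2) h3
    _ = _ := by ring

variable (n M) in
/-- **the `ℓ¹` size of the gradient**: `NgOne v = Σ_ν Σ_b |(∇_ν v)(b)|` (= `‖Dg1 A‖` of p38's `Vg1` for `v = ofLp A`, `norm_Dg1_eq_NgOne`).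
[cite: Balaban1984PropagatorsI, (1.108) p.35 (|∇A|), p.39 L7–9] -/
def NgOne (v : Bnd n M → ℝ) : ℝ := ∑ ν : Fin d, l1 (fdiffR n M ν *ᵥ v)

/-- `0 ≤ NgOne v`. [cite: Balaban1984PropagatorsI, p.39 L7–9] -/
theorem NgOne_nonneg (v : Bnd n M → ℝ) : 0 ≤ NgOne n M v := Finset.sum_nonneg fun _ _ => l1_nonneg _

/-- **THE LAPLACIAN PART OF THE LOCAL BOUND IN `ℓ¹`**: `Σ_b|[h_z, Δ]v(b)| ≤ 2(Lw/M₀)·NgOne v + d(K2/M₀²)·Σ|v|` — summing the axes produces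
the `ℓ¹` gradient size itself (no factor `d` on it). [cite: Balaban1984PropagatorsI, (1.121) p.37, (1.128) p.38, p.39 L7–9] -/
theorem l1_commR_LapR_le (hn : 1 ≤ n) (hM₀ : 1 ≤ M₀) (z : Cen M M₀) (v : Bnd n M → ℝ) :
    l1 (commR (gz n M M₀ z) (LapR n M) v) ≤ 2 * (Lw d / M₀) * NgOne n M v + d * (K2 / (M₀ : ℝ) ^ 2) * l1 v := by
  rw [LapR_eq_sum, commR_sum]
  calc l1 (∑ ν, commR (gz n M M₀ z) ((fdiffR n M ν)ᵀ * fdiffR n M ν) v)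
      ≤ ∑ ν, l1 (commR (gz n M M₀ z) ((fdiffR n M ν)ᵀ * fdiffR n M ν) v) := l1_sum_le _ _
    _ ≤ ∑ ν : Fin d, (2 * (Lw d / M₀) * l1 (fdiffR n M ν *ᵥ v) + K2 / (M₀ : ℝ) ^ 2 * l1 v) :=
        Finset.sum_le_sum fun ν _ => l1_commR_axis_le hn hM₀ z ν v
    _ = _ := by
        rw [Finset.sum_add_distrib, Finset.sum_const, Finset.card_univ, Fintype.card_fin, nsmul_eq_mul, NgOne, Finset.mul_sum]
        ring

/-- **THE `aQ*Q` PART OF THE LOCAL BOUND IN `ℓ¹`**: `Σ_b|[h_z, Q*Q]v(b)| ≤ 4(Lw/M₀)·Σ|v|` (entries `(h_z(b) − h_z(b′))(Q*Q)_{bb′}`, range `4`,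
COLUMN sums `1` — p37's `QQ_colsum`). [cite: Balaban1984PropagatorsI, (1.121) p.37 («S*(∂h)QA − Q*S(∂h)A»), (1.18) p.20, p.39 L7–9] -/
theorem l1_commR_QQR_le (hn : 1 ≤ n) (hM₀ : 1 ≤ M₀) (z : Cen M M₀) (v : Bnd n M → ℝ) :
    l1 (commR (gz n M M₀ z) (QQR n M) v) ≤ 4 * (Lw d / M₀) * l1 v := by
  set g := gz n M M₀ z with hg
  set k : Bnd n M → Bnd n M → ℝ := fun b j => (g b - g j) * QQR n M b j with hk
  have hL : 0 ≤ Lw d / M₀ := div_nonneg (Lw_nonneg d) (Nat.cast_nonneg _)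
  have e : commR g (QQR n M) v = kerOpS k v := by
    funext b
    rw [kerOpS_apply]
    simp only [commR, hk, Matrix.mulVec, dotProduct, Finset.mul_sum, ← Finset.sum_sub_distrib]
    exact Finset.sum_congr rfl fun j _ => by ring
  have hent : ∀ b j, |k b j| ≤ 4 * (Lw d / M₀) * ‖(QvAdj n M * QvOp n M) b j‖ := by
    intro b j
    rw [hk, abs_mul]
    by_cases h0 : (QvAdj n M * QvOp n M) b j = 0
    · have : QQR n M b j = 0 := by rw [QQR, B5RealFields.reM_apply, h0, Complex.zero_re]
      rw [this, h0, abs_zero, mul_zero, norm_zero, mul_zero]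
    · have hd := distU_le_four_of_QQ_ne_zero n M h0
      calc |g b - g j| * |QQR n M b j| ≤ (Lw d / M₀ * distU n M b.1 j.1) * ‖(QvAdj n M * QvOp n M) b j‖ :=
            mul_le_mul (abs_gz_sub_le hn hM₀ z b j) (abs_QQR_le b j) (abs_nonneg _) (mul_nonneg hL (distU_nonneg _ _))
        _ ≤ (Lw d / M₀ * 4) * ‖(QvAdj n M * QvOp n M) b j‖ := by gcongr
        _ = _ := by ring
  have hcol : ∀ j, ∑ b, |k b j| ≤ 4 * (Lw d / M₀) := fun j =>
    calc ∑ b, |k b j| ≤ ∑ b, 4 * (Lw d / M₀) * ‖(QvAdj n M * QvOp n M) b j‖ := Finset.sum_le_sum fun b _ => hent b j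
      _ = 4 * (Lw d / M₀) := by rw [← Finset.mul_sum, QQ_colsum n M j, mul_one]
  rw [e]
  exact l1_kerOpS_le hcol v

/-- **THE LOCAL BOUND (1.121) IN `ℓ¹` FOR `Δ + aQ*Q`**: `Σ_b|[h_z, Δ + aQ*Q]v(b)| ≤ 2(Lw/M₀)·NgOne v + (dK2/M₀² + 4|a|Lw/M₀)·Σ|v|`.
[cite: Balaban1984PropagatorsI, (1.121) p.37, (1.128) p.38, p.39 L7–9] -/
theorem l1_commR_Lloc_le (hn : 1 ≤ n) (hM₀ : 1 ≤ M₀) (z : Cen M M₀) (v : Bnd n M → ℝ) :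
    l1 (commR (gz n M M₀ z) (Lloc n M a) v)
      ≤ 2 * (Lw d / M₀) * NgOne n M v + (d * (K2 / (M₀ : ℝ) ^ 2) + |a| * (4 * (Lw d / M₀))) * l1 v := by
  rw [Lloc, commR_add, commR_smul]
  have h1 := l1_commR_LapR_le hn hM₀ z v
  have h2 := l1_commR_QQR_le hn hM₀ z v
  have h3 : l1 (fun b => a * commR (gz n M M₀ z) (QQR n M) v b) ≤ |a| * (4 * (Lw d / M₀) * l1 v) := by
    rw [l1_const_mul]
    exact mul_le_mul_of_nonneg_left h2 (abs_nonneg a)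
  calc _ ≤ l1 (commR (gz n M M₀ z) (LapR n M) v) + l1 (fun b => a * commR (gz n M M₀ z) (QQR n M) v b) := l1_add_le _ _
    _ ≤ _ := add_le_add h1 h3
    _ = _ := by ring

/-- **THE FIELD `SchemaOne.local_l1` FOR THE OPERATORS OF RECORD**: `l1 ([h_z, Δ + aQ*Q] v) ≤ ℓ₁(NgOne v + l1 v)` with THE SAME
`ℓ₁ = (2dLw + dK2 + 4|a|Lw)/M₀ = O(M₀⁻¹)` as the sup side (`B5SupRepTorus.local_normP_holds`) and p38's `L²` `local_norm_holds`.
[cite: Balaban1984PropagatorsI, (1.121) p.37, (1.128) p.38 («the small factor O(M₀⁻¹) only»), p.39 L7–9] -/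
theorem local_l1_holds (hn : 1 ≤ n) (hM₀ : 1 ≤ M₀) (z : Cen M M₀) (v : Bnd n M → ℝ) :
    l1 ((mulOpS (hcoefS n M M₀ z) * kerOpS (fun i j => Lloc n M a i j)
        - kerOpS (fun i j => Lloc n M a i j) * mulOpS (hcoefS n M M₀ z)) v)
      ≤ (2 * d * Lw d + d * K2 + 4 * |a| * Lw d) / M₀ * (NgOne n M v + l1 v) := by
  have hM0 : (0 : ℝ) < M₀ := by exact_mod_cast hM₀
  have hM1 : (1 : ℝ) ≤ M₀ := by exact_mod_cast hM₀
  have hLw := Lw_nonneg d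
  have hK2 := K2_nonneg
  have hN := NgOne_nonneg (n := n) (M := M) v
  have hA := l1_nonneg v
  -- the commutator IS p38's `commR`, pointwise
  have e : (mulOpS (hcoefS n M M₀ z) * kerOpS (fun i j => Lloc n M a i j)
        - kerOpS (fun i j => Lloc n M a i j) * mulOpS (hcoefS n M M₀ z)) v = commR (gz n M M₀ z) (Lloc n M a) v := by
    funext b
    rw [comm_plain_apply, hcoefS_eq_gz]
  rw [e]
  rcases Nat.eq_zero_or_pos d with hd | hd
  · -- no axes: the bond index set is empty and every `l1` vanishes
    subst hd
    have hn' : ∀ w : Bnd n M → ℝ, l1 w = 0 := fun w => by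
      unfold l1
      exact Finset.sum_eq_zero fun b _ => (Fin.elim0 b.2 : |w b| = 0)
    rw [hn']
    positivity
  have hd1 : (1 : ℝ) ≤ d := by exact_mod_cast hd
  set ℓ₁ : ℝ := (2 * d * Lw d + d * K2 + 4 * |a| * Lw d) / M₀ with hℓ₁
  have h1 : 2 * (Lw d / M₀) ≤ ℓ₁ := by
    rw [hℓ₁, le_div_iff₀ hM0]
    have e1 : 2 * (Lw d / (M₀ : ℝ)) * M₀ = 2 * Lw d := by field_simp
    rw [e1]
    have : (0 : ℝ) ≤ d * K2 + 4 * |a| * Lw d := by positivity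
    nlinarith
  have h2 : d * (K2 / (M₀ : ℝ) ^ 2) + |a| * (4 * (Lw d / M₀)) ≤ ℓ₁ := by
    rw [hℓ₁, le_div_iff₀ hM0]
    have e2 : (d * (K2 / (M₀ : ℝ) ^ 2) + |a| * (4 * (Lw d / M₀))) * M₀ = d * K2 / M₀ + 4 * |a| * Lw d := by
      field_simp
    rw [e2]
    have h3 : d * K2 / (M₀ : ℝ) ≤ d * K2 := div_le_self (by positivity) hM1
    have h4 : (0 : ℝ) ≤ 2 * d * Lw d := by positivity
    linarith
  calc _ ≤ 2 * (Lw d / M₀) * NgOne n M v + (d * (K2 / (M₀ : ℝ) ^ 2) + |a| * (4 * (Lw d / M₀))) * l1 v :=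
        l1_commR_Lloc_le hn hM₀ z v
    _ ≤ ℓ₁ * NgOne n M v + ℓ₁ * l1 v := add_le_add (mul_le_mul_of_nonneg_right h1 hN) (mul_le_mul_of_nonneg_right h2 hA)
    _ = ℓ₁ * (NgOne n M v + l1 v) := by ring

end Local

/-! ## §2 The `ℓ¹` schema instantiated for the operators of record -/

section Schema

variable {n : ℕ} [NeZero n] {M : Fin d → ℕ} [hM : ∀ μ, NeZero (M μ)] {a : ℝ}

/-- **own `SchemaOne` INSTANTIATED** for `Δ_a` of record on `T_η × {1..d}` (profiles `hcoefS`, centres `ctr`, `s = ⅔M₀`, `ℓ = Lw/M₀`,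
`ℓ₁ = (2dLw + dK2 + 4|a|Lw)/M₀`, `ρ = 4`, kernel constant `Cη^d`, size `NgOne`, row sums `d·η^{−d}e^{δ/4}K_d(δ/8)`).
[cite: Balaban1984PropagatorsI, (1.121) p.37, (1.126) p.38, (1.128) p.38, p.39 L7–9] -/
theorem schemaOne_holds (hn : 1 ≤ n) {M₀ : ℕ} (hM₀ : 1 ≤ M₀) {δ C : ℝ} (hδ : 0 < δ) (hC : 0 ≤ C)
    (hV : ∀ i j : Bnd n M, ‖VC n M i j‖ ≤ C * ((n : ℝ) ^ d)⁻¹ * Real.exp (-(δ * distU n M i.1 j.1))) :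
    SchemaOne (fun b : Bnd n M => ucPt M n b.1) (hcoefS n M M₀) (ctr M M₀) (fun i j => Lloc n M a i j) (fun i j => kmat n M i j)
      (NgOne n M) (2 / 3 * M₀) (Lw d / M₀) ((2 * d * Lw d + d * K2 + 4 * |a| * Lw d) / M₀) 4 (C * ((n : ℝ) ^ d)⁻¹) δ
      (d * ((n : ℝ) ^ d * (Real.exp (2 * (δ / 8)) * B4Sect5Proof.latticeConst d (δ / 8)))) where
  abs_le := fun z b => abs_hcoefS_le_one z b
  supp := fun z b h => dist_ctr_le_of_hz_ne_zero M hM₀ h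
  lip := fun z b b' => abs_hz_sub_le M hM₀ z _ _
  lip_nonneg := div_nonneg (Lw_nonneg d) (Nat.cast_nonneg _)
  range := by
    intro i j hfar
    show Lloc n M a i j = 0
    by_contra hne
    have h4 := distU_le_of_Lloc_ne_zero hn hne
    rw [dist_ucPt_eq_distU hn] at hfar
    linarith
  local_l1 := fun z v => local_l1_holds hn hM₀ z v
  N_nonneg := fun v => NgOne_nonneg v
  loc_nonneg := by
    have := Lw_nonneg d
    have := K2_nonneg
    positivity
  decay := fun i j => by
    show |kmat n M i j| ≤ _
    rw [dist_ucPt_eq_distU hn]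
    exact (abs_kmat_le i j).trans (hV i j)
  C_nonneg := by positivity
  δ_pos := hδ
  rowsum := fun b => rowsum_plain_le hn (by positivity) b
  Λ_nonneg := by
    have := B4Sect5Proof.latticeConst_nonneg d (le_of_lt (by positivity : (0 : ℝ) < δ / 8))
    positivity

/-- **(1.128) IN `ℓ¹` FOR THE REAL OPERATORS OF RECORD** (`Hs`, `DAs` read with `l1`): given ‖(∂P∂*)_{ij}‖ ≤ Cη^d e^{−δ|x_i−x_j|},
`l1 (Hs z₁ (Kop DAs Hs z₂ v)) ≤ (thetaW d a δ C/M₀)·e^{−twoDelta0 δ M₀·dist(ctr z₁, ctr z₂)}·(NgOne v + l1 v)` — the same constant `thetaW` as the sup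
side (the plain row sum lacks the factor `|Gr d| ≥ 1`). [cite: Balaban1984PropagatorsI, (1.128) p.38, p.39 L7–9] -/
theorem h128one_l1 (hn : 1 ≤ n) {M₀ : ℕ} (hM₀ : 1 ≤ M₀) {δ C : ℝ} (hδ : 0 < δ) (hC : 0 ≤ C)
    (hV : ∀ i j : Bnd n M, ‖VC n M i j‖ ≤ C * ((n : ℝ) ^ d)⁻¹ * Real.exp (-(δ * distU n M i.1 j.1)))
    (z₁ z₂ : Cen M M₀) (v : Bnd n M → ℝ) :
    l1 (Hs n M M₀ z₁ (Kop (DAs n M a) (Hs n M M₀) z₂ v))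
      ≤ thetaW d a δ C / M₀ * Real.exp (-(twoDelta0 δ M₀ * dist (ctr M M₀ z₁) (ctr M M₀ z₂))) * (NgOne n M v + l1 v) := by
  have hM0 : (0 : ℝ) < M₀ := by exact_mod_cast hM₀
  have hM1 : (1 : ℝ) ≤ M₀ := by exact_mod_cast hM₀
  have hn0 : ((n : ℝ) ^ d) ≠ 0 := pow_ne_zero _ (Nat.cast_ne_zero.mpr (NeZero.ne n))
  have hs : 2 / 3 * (M₀ : ℝ) ≤ 2 * M₀ := by linarith
  have hS := schemaOne_holds (a := a) hn hM₀ hδ hC hV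
  have h := h128_schemaOne hS hM0 hs z₁ z₂ v
  have eH : (Hs n M M₀) = fun z => mulOpS (hcoefS n M M₀ z) := rfl
  rw [Hs_eq, DAs_eq_split, eH]
  refine h.trans ?_
  have hE : 0 ≤ Real.exp (-(twoDelta0 δ M₀ * dist (ctr M M₀ z₁) (ctr M M₀ z₂))) := (Real.exp_pos _).le
  have hN : 0 ≤ NgOne n M v + l1 v := add_nonneg (NgOne_nonneg v) (l1_nonneg v)
  refine mul_le_mul_of_nonneg_right (mul_le_mul_of_nonneg_right ?_ hE) hN
  -- the constant is `≤ thetaW/M₀`: the sup-side arithmetic verbatim (`B5SupRepTorus.h128P_holds`)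
  have hLw := Lw_nonneg d
  have hK2 := K2_nonneg
  have hK := B4Sect5Proof.latticeConst_nonneg d (le_of_lt (by positivity : (0 : ℝ) < δ / 8))
  have hGr : (1 : ℝ) ≤ Fintype.card (Gr d) := by
    have : 0 < Fintype.card (Gr d) := Fintype.card_pos_iff.mpr ⟨Sum.inl ()⟩
    exact_mod_cast this
  have h1 : (2 * d * Lw d + d * K2 + 4 * |a| * Lw d) / M₀ * Real.exp (4 + 4 / M₀)
      ≤ (2 * d * Lw d + d * K2 + 4 * |a| * Lw d) * Real.exp 8 / M₀ := by
    rw [div_mul_eq_mul_div]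
    refine div_le_div_of_nonneg_right (mul_le_mul_of_nonneg_left (Real.exp_le_exp.mpr ?_) (by positivity)) hM0.le
    have : 4 / (M₀ : ℝ) ≤ 4 := div_le_self (by norm_num) hM1
    linarith
  have h2 : Lw d / M₀ * (C * ((n : ℝ) ^ d)⁻¹) * (24 / (Real.exp 1 * δ))
        * (d * ((n : ℝ) ^ d * (Real.exp (2 * (δ / 8)) * B4Sect5Proof.latticeConst d (δ / 8)))) * Real.exp 7
      = Lw d * C * (24 / (Real.exp 1 * δ)) * (d * (Real.exp (2 * (δ / 8)) * B4Sect5Proof.latticeConst d (δ / 8)))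
        * Real.exp 7 / M₀ := by
    field_simp
  have h3 : Lw d * C * (24 / (Real.exp 1 * δ)) * (d * (Real.exp (2 * (δ / 8)) * B4Sect5Proof.latticeConst d (δ / 8)))
        * Real.exp 7 / M₀
      ≤ Lw d * C * (24 / (Real.exp 1 * δ))
        * (Fintype.card (Gr d) * (d * (Real.exp (2 * (δ / 8)) * B4Sect5Proof.latticeConst d (δ / 8)))) * Real.exp 7 / M₀ := by
    refine div_le_div_of_nonneg_right (mul_le_mul_of_nonneg_right (mul_le_mul_of_nonneg_left ?_ (by positivity))
      (Real.exp_pos _).le) hM0.le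
    have h0 : 0 ≤ (d * (Real.exp (2 * (δ / 8)) * B4Sect5Proof.latticeConst d (δ / 8)) : ℝ) := by positivity
    calc (d * (Real.exp (2 * (δ / 8)) * B4Sect5Proof.latticeConst d (δ / 8)) : ℝ)
        = 1 * (d * (Real.exp (2 * (δ / 8)) * B4Sect5Proof.latticeConst d (δ / 8))) := (one_mul _).symm
      _ ≤ Fintype.card (Gr d) * (d * (Real.exp (2 * (δ / 8)) * B4Sect5Proof.latticeConst d (δ / 8))) :=
          mul_le_mul_of_nonneg_right hGr h0
  rw [h2, thetaW]
  calc _ ≤ (2 * d * Lw d + d * K2 + 4 * |a| * Lw d) * Real.exp 8 / M₀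
        + Lw d * C * (24 / (Real.exp 1 * δ))
          * (Fintype.card (Gr d) * (d * (Real.exp (2 * (δ / 8)) * B4Sect5Proof.latticeConst d (δ / 8)))) * Real.exp 7 / M₀ :=
        add_le_add h1 h3
    _ = _ := by rw [← add_div]

end Schema

/-! ## §3 The adjoint carrier: `h128` for `H1`, `DA1`, `Dg1` -/

section Adjoint

variable {n : ℕ} [NeZero n] {M : Fin d → ℕ} [hM : ∀ μ, NeZero (M μ)] {M₀ : ℕ} {a : ℝ}

/-- the `ℓ¹` norm of the adjoint carrier IS `l1` of the underlying function. [cite: Balaban1984PropagatorsI, p.39 L7–9] -/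
theorem norm_V1_eq_l1 (A : V1 n M) : ‖A‖ = l1 (ofLp A) := by
  rw [norm_V1]
  rfl

/-- the `ℓ¹` norm of the gradient IS `NgOne` of the underlying function. [cite: Balaban1984PropagatorsI, (1.108) p.35, p.39 L7–9] -/
theorem norm_Dg1_eq_NgOne (A : V1 n M) : ‖Dg1 n M A‖ = NgOne n M (ofLp A) := by
  rw [norm_Vg1, NgOne, Fintype.sum_prod_type]
  rfl

/-- `Kop` unfolds pointwise: `Kop Δa H z A = H z (Δa A) − Δa (H z A)`. [cite: Balaban1984PropagatorsI, (1.121) p.37 (K(h) = hΔ_a − Δ_a h)] -/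
theorem Kop_apply_eq {V : Type} [AddCommGroup V] [Module ℝ V] {S : Type} (Δa : Module.End ℝ V) (H : S → Module.End ℝ V) (z : S)
    (A : V) : Kop Δa H z A = H z (Δa A) - Δa (H z A) := by
  simp only [Kop, LinearMap.sub_apply, Module.End.mul_apply]

/-- **the adjoint-carrier walk step acts through `ofLp`**: `ofLp (H1 z₁ (Kop DA1 H1 z₂ A)) = Hs z₁ (Kop DAs Hs z₂ (ofLp A))` (p38's operators
are the conjugates of the real ones along `WithLp`). [cite: Balaban1984PropagatorsI, p.39 L7–9, (1.121) p.37] -/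
theorem ofLp_Kop_H1_DA1 (z₁ z₂ : Cen M M₀) (A : V1 n M) :
    ofLp (H1 n M M₀ z₁ (Kop (DA1 n M a) (H1 n M M₀) z₂ A)) = Hs n M M₀ z₁ (Kop (DAs n M a) (Hs n M M₀) z₂ (ofLp A)) := by
  rw [Kop_apply_eq, Kop_apply_eq]
  unfold H1 DA1
  rw [ofLp_conj_apply, map_sub, WithLp.ofLp_sub, ofLp_conj_apply, ofLp_conj_apply, ofLp_conj_apply, ofLp_conj_apply, map_sub]

/-- **THE FIELD `h128` OF `B5SupWalkS1.Rep` ON THE ADJOINT CARRIER OF RECORD** («a representation of G adjoint to (1.123), with the operators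
K(h) acting on the right», p. 39; (1.128) p. 38): given ‖(∂P∂*)_{ij}‖ ≤ Cη^d e^{−δ|x_i−x_j|}, for all centres and all `A : V1 n M`,
`‖H1 z₁ (Kop DA1 H1 z₂ A)‖ ≤ (thetaW d a δ C/M₀)·e^{−twoDelta0 δ M₀·dist(ctr z₁, ctr z₂)}·(‖Dg1 A‖ + ‖A‖)` — THE SAME CONSTANT AS THE SUP SIDE.
[cite: Balaban1984PropagatorsI, (1.128) p.38, p.39 L7–9, (1.121) p.37, (1.126) p.38] -/
theorem h128one_holds (hn : 1 ≤ n) (hM₀ : 1 ≤ M₀) {δ C : ℝ} (hδ : 0 < δ) (hC : 0 ≤ C)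
    (hV : ∀ i j : Bnd n M, ‖VC n M i j‖ ≤ C * ((n : ℝ) ^ d)⁻¹ * Real.exp (-(δ * distU n M i.1 j.1)))
    (z₁ z₂ : Cen M M₀) (A : V1 n M) :
    ‖H1 n M M₀ z₁ (Kop (DA1 n M a) (H1 n M M₀) z₂ A)‖
      ≤ thetaW d a δ C / M₀ * Real.exp (-(twoDelta0 δ M₀ * dist (ctr M M₀ z₁) (ctr M M₀ z₂))) * (‖Dg1 n M A‖ + ‖A‖) := by
  rw [norm_V1_eq_l1, ofLp_Kop_H1_DA1, norm_Dg1_eq_NgOne, norm_V1_eq_l1]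
  exact h128one_l1 (a := a) hn hM₀ hδ hC hV z₁ z₂ (ofLp A)

end Adjoint

/-! ## §4 The adjoint representation of record -/

section RepOfRecord

variable (n : ℕ) [NeZero n] (M : Fin d → ℕ) [hM : ∀ μ, NeZero (M μ)] (a : ℝ) (k : ℕ) (M₀ : ℕ)

/-- **THE ADJOINT REPRESENTATION OF RECORD** — `B5SupWalkS1.Rep` INHABITED on p38's adjoint carrier `V1 n M = PiLp 1 (T_η × {1..d} → ℝ)` for
`G = Δ_a⁻¹` of record, every `n ≥ 1`, torus `M`, `a > 0`, `k`, `M₀ ≥ 1`, and every `κ` with `thetaW d a ≤ κ.thetaBar` (pointwise on `δ > 0`,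
`C ≥ 0`) and `1 ≤ κ.cG`: `G = G1`, `Δ_a = DA1`, `h_z = H1 z`, `∇ = Dg1` with (1.118) `h118one`, (1.71) `DA1_mul_G1`/`G1_mul_DA1`, `norm_H1_le`,
(1.115) by duality `h115one_holds` (all p38's FILE A) and `h128` = `h128one_holds` ∘ p38's `entry_le_of_kdW`.
[cite: Balaban1984PropagatorsI, p.39 L7–9, (1.71) p.30, (1.115), (1.118) p.36, (1.123) p.37, (1.128) p.38] -/
def repOne (hn : 1 ≤ n) (ha : 0 < a) (hM₀ : 1 ≤ M₀) (κ : SupConsts)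
    (hθ : ∀ δ C : ℝ, 0 < δ → 0 ≤ C → thetaW d a δ C ≤ κ.thetaBar δ C) (hcG : 1 ≤ κ.cG) :
    Rep (latticeSettingP12R n M a k) (kdW n M) (gP12R M n a k) M₀ κ (V1 n M) (Vg1 n M) (TorR M) (Cen M M₀) (ctr M M₀) where
  G := G1 n M a
  Δa := DA1 n M a
  H := H1 n M M₀
  Dg := Dg1 n M
  h118 := h118one
  h71 := DA1_mul_G1 hn ha
  h71' := G1_mul_DA1 hn ha
  normH := norm_H1_le
  h115 := fun C Cα Cε Cαε hC hG => h115one_holds k hn ha hcG C Cα Cε Cαε hC hG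
  h128 := fun δ C hδ hC hker z₁ z₂ A => by
    have hV := entry_le_of_kdW hker
    have h := h128one_holds (a := a) hn hM₀ hδ hC.le hV z₁ z₂ A
    have hM0 : (0 : ℝ) < M₀ := by exact_mod_cast hM₀
    have hE : 0 ≤ Real.exp (-(twoDelta0 δ M₀ * dist (ctr M M₀ z₁) (ctr M M₀ z₂))) := (Real.exp_pos _).le
    have hN : 0 ≤ ‖Dg1 n M A‖ + ‖A‖ := by positivity
    refine h.trans (mul_le_mul_of_nonneg_right (mul_le_mul_of_nonneg_right ?_ hE) hN)
    exact div_le_div_of_nonneg_right (hθ δ C hδ hC.le) hM0.le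

/-- **`repOne` at `κ.thetaBar = thetaBarS d a`** (the same normal form as the direct `B5SupRepTorus.repS_thetaBarS`: ONE `κ` serves both
representations). [cite: Balaban1984PropagatorsI, (1.128) p.38, p.39] -/
def repOne_thetaBarS (hn : 1 ≤ n) (ha : 0 < a) (hM₀ : 1 ≤ M₀) (κ : SupConsts) (hκ : κ.thetaBar = thetaBarS d a)
    (hcG : 1 ≤ κ.cG) :
    Rep (latticeSettingP12R n M a k) (kdW n M) (gP12R M n a k) M₀ κ (V1 n M) (Vg1 n M) (TorR M) (Cen M M₀) (ctr M M₀) :=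
  repOne n M a k M₀ hn ha hM₀ κ (fun δ C hδ hC => by rw [hκ]; exact thetaW_le_thetaBarS d a hδ hC) hcG

end RepOfRecord

end

end Literature.MathematicalPhysics.QuantumFieldTheory.Balaban1983to89.B5OneH128Torus
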